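import Literature.NumberTheory.EllipticCurves.ShuZhai2021.GeneralizedBirchLemma
import HarnessLib

/-!
# Shu–Zhai 2021 (Crelle 775), §5.2 Table — the row `36a1` AS PRINTED: `36a1` is an optimal curve with
# `f([0]) ∉ 2E(ℚ)` (statement-only named fact; the per-curve input of Thm 1.2 / Thm 1.4 at `E = 36a1`)

HONEST FRAMING (cell `bsd-print-cf2`, D-0131 (2) PRINT TIER, leaf CornerF @ `p = 2`; prover seat p3,
typed at the literature typer's OFFER 2026-08-27T13:46:56Z): a PUBLISHED per-curve assertion vendored
as a named `Prop` (nothing asserted, nothing discharged; D-0014), with a locator into the held text.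
It is the ONLY non-kernel, non-theorem input of the Shu–Zhai `36a1` slice of the leaf
(`Summits/BirchSwinnertonDyer/Rank1Residual/P2/ShuZhaiThirtySix*.lean`): the optimal modular
parametrisation `f : X₀(36) → 36a1` and the position of the torsion point `f([0])` are values of
modular symbols / `L(36a1, 1) = Ω/6`, which the kernel cannot evaluate. Nothing booked here.

Source. J. Shu, S. Zhai, *Generalized Birch lemma and the 2-part of the Birch and Swinnerton-Dyer
conjecture for certain elliptic curves*, J. reine angew. Math. **775** (2021), 117–143 = arXiv:2102.11808
[ShuZhai2021]. Text read: the held LaTeX-derived text `paper:arxiv-2102.11808`, §5.2 = chunk p0014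
L67–L91, §1 = chunk p0003.

## The printed statement (verbatim)

* §1 (p0003 L3): "we let `f : X₀(N) → E` be an optimal modular parametrization sending the cusp at
  infinity `[∞]` to the zero element of `E`. We write `[0]` for the cusp of `X₀(N)` arising from the zero
  point in `ℙ¹(ℚ)` … By the theorem of Manin–Drinfeld, `f([0])` is a torsion point in `E(ℚ)`."
* §5.2 (p0014 L67–L69): "The theorem can be applied on the family of quadratic twists of many elliptic
  curves `E/ℚ`, we include a table here when the conductor of `E` is less than `100`." Table caption:
  "`E/ℚ` satisfying `f([0]) ∉ 2E(ℚ)` and Condition (Tor) with conductor `N < 100`." Columns: `E`,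
  `ℚ(E[2])`, `ℚ(E′[2])`, admissible primes `q`, `p`. Row (L87):
  "`36a1 | ℚ(√−3) | ℚ(√3) | 5, 17, 29, 41, 53, 89, 101, 113, … | 23, 47, 71, 167, 191, 239, …`".

## Transcription (tree dictionary of `ShuZhai2021/GeneralizedBirchLemma.lean`)

"`E = 36a1` optimal with parametrisation `f`" = a datum `Dt : ModularParametrizationData W (N(W))` of a
globally minimal model `W` of `36a1` at the conductor level, satisfying the lattice equality
`IsOptimalDatum W Dt`; "`f([0]) ∉ 2E(ℚ)`" = `CuspZeroNotInTwice W Dt`. The model used is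
`W = [0, −3, 0, 3, 0]` (`y² = x³ − 3x² + 3x`), which is Cremona's `36a1 = [0, 0, 0, 0, 1]`
(`y² = X³ + 1`) translated by `X = x − 1` (`u = 1`): the two equations have the same Néron lattice and
differential, so one datum serves both; this is the model on which the consumer
(`Summits/…/P2/ShuZhaiThirtySixCurve.lean`) proves the other columns of the row IN THE KERNEL —
(Tor) (`#E(ℚ)[2] = 2 = #E′(ℚ)[2]`, reduction mod `5`), `ℚ(E[2]) = ℚ(√−3)`, `ℚ(E′[2]) = ℚ(√3)`, the
admissible primes `= {q ≡ 5 (mod 12)}` and `p ∈ {p ≡ 23 (mod 24)}` — so ONLY the two non-decidable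
entries (optimality datum, `f([0]) ∉ 2E(ℚ)`) are transcribed. The `NeZero` witness for the level is
packed in the statement (the conductor is positive; any two witnesses agree). Nothing weaker or stronger
is transcribed; no `_holds` expected (it needs `L(36a1,1)/Ω = 1/6` exactly and the identification of
`f([0])` with a point of order `6` of `36a1(ℚ) ≅ ℤ/6`). Status: PUB (refereed); a per-curve
computational table entry (modular symbols for `Γ₀(36)`), flag word for the referee: TABLE.

## References
* [ShuZhai2021] §1 (chunk p0003 L3), §5.2 Table row 36a1 (chunk p0014 L67–L87).
* [Cremona1997] Table 1 (curve 36a1 is the `Γ₀(36)`-optimal curve of its class).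
-/

noncomputable section

open WeierstrassCurve Literature.NumberTheory.EllipticCurves
  Literature.NumberTheory.EllipticCurves.ModularForms

namespace Literature.NumberTheory.EllipticCurves.ShuZhai2021

/-- **Shu–Zhai 2021, §5.2 Table, row `36a1`** (verbatim in the module docstring): the optimal curve
`36a1` — on its globally minimal model `[0,−3,0,3,0]` (`= [0,0,0,0,1]` shifted by `x ↦ x − 1`) — admits
an optimal modular parametrisation datum `Dt` at level `N(E)` (lattice equality, `IsOptimalDatum`) with
`f([0]) ∉ 2E(ℚ)` (`CuspZeroNotInTwice`). Statement only; TABLE entry (modular-symbol computation) in a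
refereed paper; no `_holds` expected.
[cite: ShuZhai2021, §5.2 Table (row 36a1) and §1 (arXiv:2102.11808 chunk p0014 L67–L87, chunk p0003 L3)] -/
def table52_row36a1 : Prop :=
  ∃ (_ : NeZero ((⟨0, -3, 0, 3, 0⟩ : WeierstrassCurve ℚ).conductorNorm ℤ))
    (Dt : ModularParametrizationData (⟨0, -3, 0, 3, 0⟩ : WeierstrassCurve ℚ)
      ((⟨0, -3, 0, 3, 0⟩ : WeierstrassCurve ℚ).conductorNorm ℤ)),
    IsOptimalDatum (⟨0, -3, 0, 3, 0⟩ : WeierstrassCurve ℚ) Dt ∧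
      CuspZeroNotInTwice (⟨0, -3, 0, 3, 0⟩ : WeierstrassCurve ℚ) Dt

end Literature.NumberTheory.EllipticCurves.ShuZhai2021

end
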